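import Summits.Ventures.PercRepro.Night2LocalD2NoFour
import Summits.Ventures.PercRepro.Night2LocalD2Four
import Summits.Ventures.PercRepro.Night2LocalD3Zero
import Summits.Ventures.PercRepro.Night2LocalD3KOne

/-!
# PercRepro — the (6,4) cell `|E ∖ G| = 2` WITHOUT a coloop of `M|G` is a theorem (night-2, gen 15;
THEOREM F of NIGHT-2-k0.md)

* **`localShadowHall_d2_of_two_le`** — `G ∈ flatsQ M 5`, `|E ∖ G| = 2`, every member below `G` has `|G ∖ cl B| ≥ 2`
  ⟹ `LocalShadowHall M 4 G`: either no `C ⊆ G` with `|C| ≤ 4` has `ρ(G ∖ C) ≤ 2` (THEOREM D, the pair-5 rule,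
  Night2LocalD2NoFour) or some `C` has (THEOREM E, the covering certificate, Night2LocalD2Four).
* **`localShadowHall_d2_of_kColoops_eq_zero`** — `G ∈ flatsQ M 5`, `|E ∖ G| = 2`, `kColoops M G = 0` ⟹
  `LocalShadowHall M 4 G` (a member with `|G ∖ cl B| = 1` is a layer-0 member, which needs a coloop of `M|G`).
* **`shadowHall_six_four_of_local_two_one`** — THE (6,4) SHADOW ROW FOR EVERY FINITE MATROID, MODULO the cell
  `|E ∖ G| = 2` WITH `kColoops = 1` of loopless simple rank-6 matroids (the reduction
  `shadowHall_six_four_of_local_two` of Night2LocalD3KOne with the `kColoops = 0` case discharged).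
-/

namespace PercRepro.Shadow

open Finset PerFlat ThmH

variable {α : Type*} [DecidableEq α] {M : Matroid α} [M.Finite]

open scoped Classical in
/-- **THEOREM F — the (6,4) cell `|E ∖ G| = 2` when every member has `|G ∖ cl B| ≥ 2`** (no coloop of `M|G`
carries members). -/
theorem localShadowHall_d2_of_two_le {G : Finset α} (hG : G ∈ flatsQ M (4 + 1))
    (hd : (gr M \ G).card = 2)
    (hm2 : ∀ B ∈ membersIn M (Uq M (4 + 2) 4) G, 2 ≤ (G \ clF M B).card) :
    LocalShadowHall M 4 G := by
  by_cases h4 : ∀ C ⊆ G, C.card ≤ 4 → 3 ≤ rkN M (G \ C)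
  · exact localShadowHall_d2_of_no_four hG hd hm2 h4
  · push Not at h4
    obtain ⟨C, -, hc4, hr⟩ := h4
    exact localShadowHall_d2_of_four hG hd hm2 hc4 (by omega)

open scoped Classical in
/-- Without a coloop of `M|G`, every member below a rank-`5` flat `G` with `|E ∖ G| = 2` has `|G ∖ cl B| ≥ 2`. -/
theorem two_le_card_sdiff_clF_of_kColoops_eq_zero {G : Finset α} (hG : G ∈ flatsQ M (4 + 1))
    (hd : (gr M \ G).card = 2) (hk : kColoops M G = 0) {B : Finset α}
    (hB : B ∈ membersIn M (Uq M (4 + 2) 4) G) : 2 ≤ (G \ clF M B).card := by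
  have hBU : B ∈ Uq M (4 + 2) 4 := (mem_membersIn.1 hB).1
  -- `|G ∖ cl B| ≥ 1`: `cl B` has rank `4 < 5 = ρ(G)`
  have hpos : 0 < (G \ clF M B).card := by
    rw [Finset.card_pos]
    by_contra hemp
    rw [Finset.not_nonempty_iff_eq_empty, Finset.sdiff_eq_empty_iff_subset] at hemp
    have h1 := rkN_mono (M := M) hemp
    rw [rkN_clF_eq_of_mem_Uq hBU] at h1
    have h2 : rkN M G = 4 + 1 := by
      unfold rkN
      rw [(mem_flatsQ.1 hG).2.2]
      rfl
    omega
  -- `|G ∖ cl B| ≠ 1`: a layer-0 member needs a coloop of `M|G`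
  by_contra hlt
  push Not at hlt
  have h1 : (G \ clF M B).card = 1 := by omega
  have hlay : B ∈ lay0 M 4 G := by
    rw [mem_lay0]
    exact ⟨hB, h1, by rw [hd]; norm_num⟩
  rw [lay0_eq_empty_of_kColoops_eq_zero hk] at hlay
  exact Finset.notMem_empty _ hlay

open scoped Classical in
/-- **THE (6,4) CELL `|E ∖ G| = 2` WITHOUT A COLOOP OF `M|G`.** -/
theorem localShadowHall_d2_of_kColoops_eq_zero {G : Finset α} (hG : G ∈ flatsQ M (4 + 1))
    (hd : (gr M \ G).card = 2) (hk : kColoops M G = 0) : LocalShadowHall M 4 G :=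
  localShadowHall_d2_of_two_le hG hd (fun _ hB => two_le_card_sdiff_clF_of_kColoops_eq_zero hG hd hk hB)

section SixFour

variable {α' : Type} [DecidableEq α']

/-- **THE `(6, 4)` SHADOW ROW FOR EVERY FINITE MATROID, MODULO `|E ∖ G| = 2` WITH `kColoops = 1`** of loopless
simple rank-`6` matroids. -/
theorem shadowHall_six_four_of_local_two_one
    (hloc1 : ∀ (N : Matroid α') [N.Finite], (∀ e ∈ gr N, ∀ f ∈ gr N, e ≠ f → rkN N {e, f} = 2) →
      (∀ e ∈ gr N, N.Indep {e}) → N.eRank = ((6 : ℕ) : ℕ∞) →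
      ∀ G ∈ flatsQ N (4 + 1), (gr N \ G).card = 2 → kColoops N G = 1 → LocalShadowHall N 4 G)
    (M : Matroid α') [M.Finite] : ShadowHall M 6 4 (phiK 6 4) := by
  apply shadowHall_six_four_of_local_two
  intro N _ hs hl hr G hG hd hk
  rcases Nat.lt_or_ge (kColoops N G) 1 with h0 | h1
  · exact localShadowHall_d2_of_kColoops_eq_zero hG hd (by omega)
  · exact hloc1 N hs hl hr G hG hd (by omega)

end SixFour

end PercRepro.Shadow
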